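import Literature.MathematicalPhysics.QuantumFieldTheory.O2NeutralSectorsTermwise
import Literature.MathematicalPhysics.QuantumFieldTheory.ConformalBootstrap3D.MixedOddHead
import HarnessLib

/-!
# O(2) scan, the charged `1 × 1` sectors `3` and `2⁻`: Cauchy–Schwarz domination and the termwise rule

The two charged SINGLE-coefficient conditions of the O(2) three-scalar scan
(`O2ScanObligations.Pos3`, `Pos2m`): `α(V⃗_{3,Δ,ℓ}[(−1)^ℓ][g]) ≥ 0` with labels `tφtφ` (a block
`g^{d,d}_{Δ,ℓ}`, `d = Δ_t − Δ_φ`, rows `2εF⁻`, `−2εF⁺` at exponent `(Δ_φ+Δ_t)/2`) and `φttφ` (a block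
`g^{−d,d}_{Δ,ℓ}`, rows `2F⁻`, `2F⁺` at exponent `Δ_t`), and `α(V⃗_{2⁻,Δ,ℓ}[g]) ≥ 0` with labels `tsts`
(`g^{d′,d′}`, `d′ = Δ_t − Δ_s`, row `−2F⁻` at `(Δ_s+Δ_t)/2`) and `stts` (`g^{−d′,d′}`, rows `2F⁻`, `−2F⁺`
at `Δ_t`).  As in the `σ–ε` odd sector (`ConformalBootstrap3D.MixedOddTail/MixedOddHead`), the rows
carrying the sign-indefinite block `g^{d,d}` are DOMINATED by the Cauchy–Schwarz inequality
`|g^{d,d}(z,z̄)| ≤ v^{d/2} g^{−d,d}(z,z̄)` (`IsConformalBlock3D.abs_gmm_le`; exponent identity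
`(Δ_φ+Δ_t)/2 + d/2 = Δ_t`), leaving a two-weight evaluation of the block `g^{−d,d}` alone, whose
`z`-series has the NON-NEGATIVE coefficients `A_{n,j}(d/2, d/2)/λ_ℓ` (`hrCoeffAB_self_nonneg`):

* §1 the sector values at the `z`-level (`sector3Value`, `sector2mValue`) with the dictionaries
  `F.toFunctional (V3 D ε g) = sector3Value F D ε (pullbackZ ∘ g)`, `… (V2m D g) = sector2mValue …`, and
  the genuine-block unpacking of `GenuineOn D labels3 / labels2m`;
* §2 the Cauchy–Schwarz budget of a `g^{d,d}` row for EITHER sign `σ ∈ [−1, 1]` of the crossing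
  combination (`abs_nodeEval_crossF_gmm_le`) — the tree's `abs_pointFunctional_crossF_gmm_le` is the case
  `σ = −1`; sector `3` also has an `F⁺` row of `g^{d,d}`;
* §3 the DOMINATING EVALUATIONS `dom3Eval = T(c₃, d₃; Δ_t)[G_{φttφ}]`, `c₃ = 2(w⁹+w¹¹) − 2(|w⁷|+|w⁸|)`,
  `d₃ = 2(w⁹−w¹¹) + 2(|w⁷|+|w⁸|)` and `dom2mEval = T(c₂, d₂; Δ_t)[G_{stts}]`, `c₂ = 2(w¹⁶−w¹⁷) − 2|w¹⁵|`,
  `d₂ = 2(w¹⁶+w¹⁷) + 2|w¹⁵|` (printed row numbers; tree indices are one less), with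
  `dom3Eval ≤ sector3Value`, `dom2mEval ≤ sector2mValue` on genuine blocks at a regular point above the
  bound (`Δ ≠ 1` if `ℓ = 0`);
* §4 the pairs series `hasSum_dom3Eval`, `hasSum_dom2mEval` (coefficients `A_{n,j}(d/2,d/2)/λ_ℓ`) and the
  TERMWISE RULES `pos3_of_dom_termwise`, `pos2m_of_dom_termwise` (finite head + non-negative dominated
  tail terms ⇒ `Pos3` / `Pos2m` at a regular point);
* §5 NON-REGULAR points by right limits (`pos3_of_eventually_right`, `pos2m_of_eventually_right`).

R-07.5 PLANNING for the O(2) client path; no numerics.  HONEST SCOPE: the domination discards the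
`g^{d,d}` rows entirely (a one-sided sufficient condition, exactly as strong as the tree's odd-sector
treatment, not an equivalence); the point `(Δ, ℓ) = (1, 0)` is outside the Cauchy–Schwarz estimate
(hypothesis `ℓ = 0 → Δ ≠ 1`, as in the tree) and is reached by no rule of this file; the `2 × 2` charged
sectors `1`, `2⁺` are not treated.  DECLARATIONS: definitions `sector3Value`, `sector2mValue`, `cWeight3`,
`dWeight3`, `cWeight2m`, `dWeight2m`, `dom3Eval`, `dom2mEval`, `dom3Term`, `dom2mTerm`.

References: Chester–Landry–Liu–Poland–Simmons-Duffin–Su–Vichi, JHEP 06 (2020) 142, §2.1, §3.1, App.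
«Crossing vectors» (`ChesterEtAl2020`); Kos–Poland–Simmons-Duffin, JHEP 11 (2014) 109, §3.3 eq. (3.16),
§4 eqs. (4.2)–(4.3) (`KosPolandSimmonsduffin2014`); Pappadopulo–Rychkov–Espin–Rattazzi, Phys. Rev. D 86
(2012) 105043, §5 (`PappadopuloRychkovEspinRattazzi2012`); Dolan–Osborn, Nucl. Phys. B 678 (2004) 491,
§3 eq. (3.10) (`DolanOsborn2004`).
-/

namespace Literature.MathematicalPhysics.QuantumFieldTheory.O2ChargedSectorsTermwise

open Finset Set Filter Topology
open Literature.MathematicalPhysics.QuantumFieldTheory.O2ThreeScalarCrossing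
open Literature.MathematicalPhysics.QuantumFieldTheory.O2ThreeScalarSystem
open Literature.MathematicalPhysics.QuantumFieldTheory.O2OPEScanBridge
open Literature.MathematicalPhysics.QuantumFieldTheory.O2ScanObligations
open Literature.MathematicalPhysics.QuantumFieldTheory.O2NeutralSectorsTermwise
open ConformalBootstrap3D (IsConformalBlock3D IsConformalBlock3DAbove IsRegularPoint3D unitarityBound3D
  accidentalDegeneracy3D crossF pointFunctional pointFunctional_apply zMono legendreLam legendreLam_pos
  InDescendantRange hrCoeffAB hrCoeffAB_self_nonneg hrCoeffAB_eq_zero_of_not_inDescendantRange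
  hasSum_pointFunctional_crossF_hrZAB tendsto_pointFunctional_crossF twoWeightEval)

/-! ### §1 The sector values at the `z`-level and the dictionaries -/

/-- **The charge-`3` value**: `2εΦ₇[F⁻_{(Δφ+Δt)/2}G_{tφtφ}] − 2εΦ₈[F⁺G_{tφtφ}] + 2Φ₉[F⁻_{Δt}G_{φttφ}]
+ 2Φ₁₁[F⁺_{Δt}G_{φttφ}]` (tree indices `6, 7, 8, 10`). [cite: ChesterEtAl2020, App. «Crossing vectors» (`V⃗_{3,Δ,ℓ}`)] -/
noncomputable def sector3Value (F : ScanFunctional) (D : Dims) (ε : ℝ) (G : Label → ℝ → ℝ → ℝ) : ℝ :=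
  2 * ε * nodeEval F 6 (crossF (D.expo .tφtφ) (-1) (G .tφtφ)) -
      2 * ε * nodeEval F 7 (crossF (D.expo .tφtφ) 1 (G .tφtφ)) +
    2 * nodeEval F 8 (crossF (D.expo .φttφ) (-1) (G .φttφ)) +
    2 * nodeEval F 10 (crossF (D.expo .φttφ) 1 (G .φttφ))

/-- **Dictionary, sector `3`.** [cite: ChesterEtAl2020, App. «Crossing vectors» (`V⃗_{3,Δ,ℓ}`), §3.1 (functional conditions)] -/
theorem sector3Value_eq (F : ScanFunctional) (D : Dims) (ε : ℝ) (g : Label → ℝ → ℝ → ℝ) :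
    F.toFunctional (V3 D ε g) = sector3Value F D ε (fun L => pullbackZ (g L)) := by
  rw [ScanFunctional.toFunctional, pointFunctional₂₂_apply]
  have hnode : ∀ m : Fin F.M, ∑ r, F.w m r * V3 D ε g (F.u m) (F.v m) r =
      2 * ε * (F.w m 6 * crossF (D.expo .tφtφ) (-1) (pullbackZ (g .tφtφ)) (F.z m) (F.zb m)) -
          2 * ε * (F.w m 7 * crossF (D.expo .tφtφ) 1 (pullbackZ (g .tφtφ)) (F.z m) (F.zb m)) +
        2 * (F.w m 8 * crossF (D.expo .φttφ) (-1) (pullbackZ (g .φttφ)) (F.z m) (F.zb m)) +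
        2 * (F.w m 10 * crossF (D.expo .φttφ) 1 (pullbackZ (g .φttφ)) (F.z m) (F.zb m)) := by
    intro m
    rw [sum_univ_fin22]
    simp only [V3, ScanFunctional.u, ScanFunctional.v, Fminus_pullbackZ, Fplus_pullbackZ]
    simp
    ring
  rw [Finset.sum_congr rfl fun m _ => hnode m]
  simp only [sector3Value, nodeEval_apply, Finset.mul_sum, ← Finset.sum_add_distrib,
    ← Finset.sum_sub_distrib]

/-- **The charge-`2⁻` value**: `−2Φ₁₅[F⁻_{(Δs+Δt)/2}G_{tsts}] + 2Φ₁₆[F⁻_{Δt}G_{stts}] − 2Φ₁₇[F⁺_{Δt}G_{stts}]`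
(tree indices `14, 15, 16`). [cite: ChesterEtAl2020, App. «Crossing vectors» (`V⃗_{2,Δ,ℓ⁻}`)] -/
noncomputable def sector2mValue (F : ScanFunctional) (D : Dims) (G : Label → ℝ → ℝ → ℝ) : ℝ :=
  -(2 * nodeEval F 14 (crossF (D.expo .tsts) (-1) (G .tsts))) +
      2 * nodeEval F 15 (crossF (D.expo .stts) (-1) (G .stts)) -
    2 * nodeEval F 16 (crossF (D.expo .stts) 1 (G .stts))

/-- **Dictionary, sector `2⁻`.** [cite: ChesterEtAl2020, App. «Crossing vectors» (`V⃗_{2,Δ,ℓ⁻}`), §3.1 (functional conditions)] -/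
theorem sector2mValue_eq (F : ScanFunctional) (D : Dims) (g : Label → ℝ → ℝ → ℝ) :
    F.toFunctional (V2m D g) = sector2mValue F D (fun L => pullbackZ (g L)) := by
  rw [ScanFunctional.toFunctional, pointFunctional₂₂_apply]
  have hnode : ∀ m : Fin F.M, ∑ r, F.w m r * V2m D g (F.u m) (F.v m) r =
      -(2 * (F.w m 14 * crossF (D.expo .tsts) (-1) (pullbackZ (g .tsts)) (F.z m) (F.zb m))) +
          2 * (F.w m 15 * crossF (D.expo .stts) (-1) (pullbackZ (g .stts)) (F.z m) (F.zb m)) -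
        2 * (F.w m 16 * crossF (D.expo .stts) 1 (pullbackZ (g .stts)) (F.z m) (F.zb m)) := by
    intro m
    rw [sum_univ_fin22]
    simp only [V2m, ScanFunctional.u, ScanFunctional.v, Fminus_pullbackZ, Fplus_pullbackZ]
    simp
    ring
  rw [Finset.sum_congr rfl fun m _ => hnode m]
  simp only [sector2mValue, nodeEval_apply, Finset.mul_sum, ← Finset.sum_add_distrib,
    ← Finset.sum_sub_distrib, ← Finset.sum_neg_distrib]

/-- The blocks of a family genuine on `labels3`: `G_{tφtφ} = g^{d,d}`, `G_{φttφ} = g^{−d,d}`, `d = Δ_t − Δ_φ`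
(in `z`-coordinates). [cite: ChesterEtAl2020, §2.1 (`F^{ij,kl}_{∓,Δ,ℓ}`)] -/
theorem blocks_of_genuineOn_labels3 {D : Dims} {Δ : ℝ} {ℓ : ℕ} {g : Label → ℝ → ℝ → ℝ}
    (hg : GenuineOn D labels3 Δ ℓ g) :
    IsConformalBlock3D (D.Δt - D.Δφ) (D.Δt - D.Δφ) Δ ℓ (pullbackZ (g .tφtφ)) ∧
      IsConformalBlock3D (-(D.Δt - D.Δφ)) (D.Δt - D.Δφ) Δ ℓ (pullbackZ (g .φttφ)) := by
  have h₁ := hg .tφtφ (by simp [labels3])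
  have h₂ := hg .φttφ (by simp [labels3])
  simp only [IsBlockUV, d12, d34] at h₁ h₂
  refine ⟨h₁, ?_⟩
  have hre : D.Δφ - D.Δt = -(D.Δt - D.Δφ) := by ring
  rw [hre] at h₂
  exact h₂

/-- The blocks of a family genuine on `labels2m`: `G_{tsts} = g^{d′,d′}`, `G_{stts} = g^{−d′,d′}`,
`d′ = Δ_t − Δ_s`. [cite: ChesterEtAl2020, §2.1 (`F^{ij,kl}_{∓,Δ,ℓ}`)] -/
theorem blocks_of_genuineOn_labels2m {D : Dims} {Δ : ℝ} {ℓ : ℕ} {g : Label → ℝ → ℝ → ℝ}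
    (hg : GenuineOn D labels2m Δ ℓ g) :
    IsConformalBlock3D (D.Δt - D.Δs) (D.Δt - D.Δs) Δ ℓ (pullbackZ (g .tsts)) ∧
      IsConformalBlock3D (-(D.Δt - D.Δs)) (D.Δt - D.Δs) Δ ℓ (pullbackZ (g .stts)) := by
  have h₁ := hg .tsts (by simp [labels2m])
  have h₂ := hg .stts (by simp [labels2m])
  simp only [IsBlockUV, d12, d34] at h₁ h₂
  refine ⟨h₁, ?_⟩
  have hre : D.Δs - D.Δt = -(D.Δt - D.Δs) := by ring
  rw [hre] at h₂
  exact h₂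

/-- The exponent identity of sector `3`: `(Δ_φ + Δ_t)/2 + (Δ_t − Δ_φ)/2 = Δ_t`. Bookkeeping.
[cite: ChesterEtAl2020, §2.1 (`F^{ij,kl}_{∓,Δ,ℓ}`)] -/
theorem expo_tφtφ_add_half (D : Dims) : D.expo .tφtφ + (D.Δt - D.Δφ) / 2 = D.expo .φttφ := by
  simp only [Dims.expo]
  ring

/-- The exponent identity of sector `2⁻`: `(Δ_s + Δ_t)/2 + (Δ_t − Δ_s)/2 = Δ_t`. Bookkeeping.
[cite: ChesterEtAl2020, §2.1 (`F^{ij,kl}_{∓,Δ,ℓ}`)] -/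
theorem expo_tsts_add_half (D : Dims) : D.expo .tsts + (D.Δt - D.Δs) / 2 = D.expo .stts := by
  simp only [Dims.expo]
  ring

/-! ### §2 The Cauchy–Schwarz budget of a `g^{d,d}` row, either sign -/

/-- **`|Φ_r[F^{s}_{σ}[g^{d,d}]]| ≤ T(|w_r|, −|w_r|; s + d/2)[g^{−d,d}]`** for `|σ| ≤ 1`: every node's
contribution `w (v^s g^{d,d}(z) + σ u^s g^{d,d}(1−z))` is bounded by `|w| (v^{s+d/2} g^{−d,d}(z) +
u^{s+d/2} g^{−d,d}(1−z))`, by `|g^{d,d}| ≤ v^{d/2} g^{−d,d}` at the node and at its mirror.  Regular point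
above the bound, `Δ ≠ 1` if `ℓ = 0`. [cite: PappadopuloRychkovEspinRattazzi2012, §5] -/
theorem abs_nodeEval_crossF_gmm_le (F : ScanFunctional) (r : Fin 22) {σ : ℝ} (hσ : |σ| ≤ 1)
    {d Δ : ℝ} {ℓ : ℕ} {g₁ g₂ : ℝ → ℝ → ℝ} (hΔ : unitarityBound3D ℓ < Δ)
    (hreg : ¬ accidentalDegeneracy3D Δ ℓ) (h1 : ℓ = 0 → Δ ≠ 1) (hg₁ : IsConformalBlock3D d d Δ ℓ g₁)
    (hg₂ : IsConformalBlock3D (-d) d Δ ℓ g₂) (s : ℝ) :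
    |nodeEval F r (crossF s σ g₁)| ≤
      twoWeightEval (fun m => |F.w m r|) (fun m => -|F.w m r|) F.z F.zb (s + d / 2) g₂ := by
  rw [nodeEval_apply]
  unfold twoWeightEval
  refine (abs_sum_le_sum_abs _ _).trans (sum_le_sum fun m _ => ?_)
  have hz0 := (F.hz m).1; have hz1 := (F.hz m).2; have hzb0 := (F.hzb m).1; have hzb1 := (F.hzb m).2
  have hv : 0 < (1 - F.z m) * (1 - F.zb m) := mul_pos (by linarith) (by linarith)
  have hu : 0 < F.z m * F.zb m := mul_pos hz0 hzb0
  have hA : |g₁ (F.z m) (F.zb m)| ≤ ((1 - F.z m) * (1 - F.zb m)) ^ (d / 2) * g₂ (F.z m) (F.zb m) :=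
    hg₁.abs_gmm_le hΔ hreg h1 hg₂ (F.hz m) (F.hzb m)
  have hB : |g₁ (1 - F.z m) (1 - F.zb m)| ≤ (F.z m * F.zb m) ^ (d / 2) * g₂ (1 - F.z m) (1 - F.zb m) := by
    have h := hg₁.abs_gmm_le hΔ hreg h1 hg₂ (x := 1 - F.z m) (y := 1 - F.zb m)
      ⟨by linarith, by linarith⟩ ⟨by linarith, by linarith⟩
    simpa only [sub_sub_cancel] using h
  have e1 : |((1 - F.z m) * (1 - F.zb m)) ^ s * g₁ (F.z m) (F.zb m)| ≤
      ((1 - F.z m) * (1 - F.zb m)) ^ (s + d / 2) * g₂ (F.z m) (F.zb m) := by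
    rw [abs_mul, abs_of_pos (Real.rpow_pos_of_pos hv s), Real.rpow_add hv, mul_assoc]
    exact mul_le_mul_of_nonneg_left hA (Real.rpow_pos_of_pos hv s).le
  have e2 : |σ * (F.z m * F.zb m) ^ s * g₁ (1 - F.z m) (1 - F.zb m)| ≤
      (F.z m * F.zb m) ^ (s + d / 2) * g₂ (1 - F.z m) (1 - F.zb m) := by
    have hus : 0 < (F.z m * F.zb m) ^ s := Real.rpow_pos_of_pos hu s
    rw [abs_mul, abs_mul, abs_of_pos hus, Real.rpow_add hu, mul_assoc]
    have hX : 0 ≤ (F.z m * F.zb m) ^ s * |g₁ (1 - F.z m) (1 - F.zb m)| := mul_nonneg hus.le (abs_nonneg _)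
    calc |σ| * ((F.z m * F.zb m) ^ s * |g₁ (1 - F.z m) (1 - F.zb m)|)
        ≤ 1 * ((F.z m * F.zb m) ^ s * |g₁ (1 - F.z m) (1 - F.zb m)|) :=
          mul_le_mul_of_nonneg_right hσ hX
      _ ≤ (F.z m * F.zb m) ^ s * ((F.z m * F.zb m) ^ (d / 2) * g₂ (1 - F.z m) (1 - F.zb m)) := by
          rw [one_mul]; exact mul_le_mul_of_nonneg_left hB hus.le
      _ = (F.z m * F.zb m) ^ s * (F.z m * F.zb m) ^ (d / 2) * g₂ (1 - F.z m) (1 - F.zb m) := by ring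
  have hsum : |F.w m r * crossF s σ g₁ (F.z m) (F.zb m)| ≤
      |F.w m r| * (((1 - F.z m) * (1 - F.zb m)) ^ (s + d / 2) * g₂ (F.z m) (F.zb m) +
        (F.z m * F.zb m) ^ (s + d / 2) * g₂ (1 - F.z m) (1 - F.zb m)) := by
    rw [abs_mul]
    refine mul_le_mul_of_nonneg_left ?_ (abs_nonneg _)
    unfold crossF
    have hre : ((1 - F.z m) * (1 - F.zb m)) ^ s * g₁ (F.z m) (F.zb m) +
        σ * (F.z m * F.zb m) ^ s * g₁ (1 - F.z m) (1 - F.zb m) =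
        ((1 - F.z m) * (1 - F.zb m)) ^ s * g₁ (F.z m) (F.zb m) +
          (σ * (F.z m * F.zb m) ^ s * g₁ (1 - F.z m) (1 - F.zb m)) := rfl
    exact (abs_add_le _ _).trans (add_le_add e1 e2)
  refine hsum.trans (le_of_eq ?_)
  ring

/-! ### §3 The dominating evaluations -/

/-- Direct weight of `𝔇₃`: `c₃ = 2(w⁹ + w¹¹) − 2(|w⁷| + |w⁸|)` (tree indices `8, 10, 6, 7`).
[cite: PappadopuloRychkovEspinRattazzi2012, §5] -/
noncomputable def cWeight3 (F : ScanFunctional) (m : Fin F.M) : ℝ :=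
  2 * (F.w m 8 + F.w m 10) - 2 * (|F.w m 6| + |F.w m 7|)

/-- Reflected weight of `𝔇₃`: `d₃ = 2(w⁹ − w¹¹) + 2(|w⁷| + |w⁸|)`. [cite: PappadopuloRychkovEspinRattazzi2012, §5] -/
noncomputable def dWeight3 (F : ScanFunctional) (m : Fin F.M) : ℝ :=
  2 * (F.w m 8 - F.w m 10) + 2 * (|F.w m 6| + |F.w m 7|)

/-- **The dominating evaluation of sector `3`**: `𝔇₃[G] = T(c₃, d₃; Δ_t)[G]`, to be applied to
`G = G_{φttφ} = g^{−d,d}`. [cite: PappadopuloRychkovEspinRattazzi2012, §5] -/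
noncomputable def dom3Eval (F : ScanFunctional) (D : Dims) (G : ℝ → ℝ → ℝ) : ℝ :=
  twoWeightEval (cWeight3 F) (dWeight3 F) F.z F.zb (D.expo .φttφ) G

/-- The dominated term of sector `3` at `𝒫_{E,j}`. [cite: PappadopuloRychkovEspinRattazzi2012, §5] -/
noncomputable def dom3Term (F : ScanFunctional) (D : Dims) (E : ℝ) (j : ℕ) : ℝ :=
  dom3Eval F D (zMono E j)

/-- `𝔇₃` split along the rows: the `φttφ` rows minus the Cauchy–Schwarz budgets of the two `tφtφ` rows.
Bookkeeping. [cite: PappadopuloRychkovEspinRattazzi2012, §5] -/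
theorem dom3Eval_eq (F : ScanFunctional) (D : Dims) (G : ℝ → ℝ → ℝ) :
    dom3Eval F D G = 2 * nodeEval F 8 (crossF (D.expo .φttφ) (-1) G) +
        2 * nodeEval F 10 (crossF (D.expo .φttφ) 1 G) -
      2 * twoWeightEval (fun m => |F.w m 6|) (fun m => -|F.w m 6|) F.z F.zb (D.expo .φttφ) G -
      2 * twoWeightEval (fun m => |F.w m 7|) (fun m => -|F.w m 7|) F.z F.zb (D.expo .φttφ) G := by
  simp only [dom3Eval, twoWeightEval, nodeEval_apply, crossF, Finset.mul_sum, ← Finset.sum_add_distrib,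
    ← Finset.sum_sub_distrib]
  exact Finset.sum_congr rfl fun m _ => by simp only [cWeight3, dWeight3]; ring

/-- **`𝔇₃[G_{φttφ}] ≤ sector3Value(ε, G)`** for `|ε| ≤ 1` on genuine blocks at a regular `(Δ, ℓ)` above
the bound (`Δ ≠ 1` if `ℓ = 0`). [cite: PappadopuloRychkovEspinRattazzi2012, §5] [cite: ChesterEtAl2020, §3.1 (functional conditions)] -/
theorem dom3Eval_le_sector3Value (F : ScanFunctional) (D : Dims) {ε : ℝ} (hε : |ε| ≤ 1) {Δ : ℝ} {ℓ : ℕ}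
    (hΔ : unitarityBound3D ℓ < Δ) (hreg : ¬ accidentalDegeneracy3D Δ ℓ) (h1 : ℓ = 0 → Δ ≠ 1)
    {G : Label → ℝ → ℝ → ℝ} (hG₁ : IsConformalBlock3D (D.Δt - D.Δφ) (D.Δt - D.Δφ) Δ ℓ (G .tφtφ))
    (hG₂ : IsConformalBlock3D (-(D.Δt - D.Δφ)) (D.Δt - D.Δφ) Δ ℓ (G .φttφ)) :
    dom3Eval F D (G .φttφ) ≤ sector3Value F D ε G := by
  have h6 := abs_nodeEval_crossF_gmm_le F 6 (σ := -1) (by simp) hΔ hreg h1 hG₁ hG₂ (D.expo .tφtφ)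
  have h7 := abs_nodeEval_crossF_gmm_le F 7 (σ := 1) (by simp) hΔ hreg h1 hG₁ hG₂ (D.expo .tφtφ)
  rw [expo_tφtφ_add_half] at h6 h7
  have h6' := mul_le_mul hε h6 (abs_nonneg _) zero_le_one
  have h7' := mul_le_mul hε h7 (abs_nonneg _) zero_le_one
  rw [← abs_mul, one_mul] at h6' h7'
  rw [dom3Eval_eq, sector3Value]
  have a6 := neg_abs_le (ε * nodeEval F 6 (crossF (D.expo .tφtφ) (-1) (G .tφtφ)))
  have a7 := le_abs_self (ε * nodeEval F 7 (crossF (D.expo .tφtφ) 1 (G .tφtφ)))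
  nlinarith [a6, a7, h6', h7']

/-- Direct weight of `𝔇₂₋`: `c₂ = 2(w¹⁶ − w¹⁷) − 2|w¹⁵|` (tree indices `15, 16, 14`).
[cite: PappadopuloRychkovEspinRattazzi2012, §5] -/
noncomputable def cWeight2m (F : ScanFunctional) (m : Fin F.M) : ℝ :=
  2 * (F.w m 15 - F.w m 16) - 2 * |F.w m 14|

/-- Reflected weight of `𝔇₂₋`: `d₂ = 2(w¹⁶ + w¹⁷) + 2|w¹⁵|`. [cite: PappadopuloRychkovEspinRattazzi2012, §5] -/
noncomputable def dWeight2m (F : ScanFunctional) (m : Fin F.M) : ℝ :=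
  2 * (F.w m 15 + F.w m 16) + 2 * |F.w m 14|

/-- **The dominating evaluation of sector `2⁻`**: `𝔇₂₋[G] = T(c₂, d₂; Δ_t)[G]`, applied to
`G = G_{stts} = g^{−d′,d′}`. [cite: PappadopuloRychkovEspinRattazzi2012, §5] -/
noncomputable def dom2mEval (F : ScanFunctional) (D : Dims) (G : ℝ → ℝ → ℝ) : ℝ :=
  twoWeightEval (cWeight2m F) (dWeight2m F) F.z F.zb (D.expo .stts) G

/-- The dominated term of sector `2⁻` at `𝒫_{E,j}`. [cite: PappadopuloRychkovEspinRattazzi2012, §5] -/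
noncomputable def dom2mTerm (F : ScanFunctional) (D : Dims) (E : ℝ) (j : ℕ) : ℝ :=
  dom2mEval F D (zMono E j)

/-- `𝔇₂₋` split along the rows. Bookkeeping. [cite: PappadopuloRychkovEspinRattazzi2012, §5] -/
theorem dom2mEval_eq (F : ScanFunctional) (D : Dims) (G : ℝ → ℝ → ℝ) :
    dom2mEval F D G = 2 * nodeEval F 15 (crossF (D.expo .stts) (-1) G) -
        2 * nodeEval F 16 (crossF (D.expo .stts) 1 G) -
      2 * twoWeightEval (fun m => |F.w m 14|) (fun m => -|F.w m 14|) F.z F.zb (D.expo .stts) G := by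
  simp only [dom2mEval, twoWeightEval, nodeEval_apply, crossF, Finset.mul_sum, ← Finset.sum_sub_distrib]
  exact Finset.sum_congr rfl fun m _ => by simp only [cWeight2m, dWeight2m]; ring

/-- **`𝔇₂₋[G_{stts}] ≤ sector2mValue(G)`** on genuine blocks at a regular `(Δ, ℓ)` above the bound
(`Δ ≠ 1` if `ℓ = 0`). [cite: PappadopuloRychkovEspinRattazzi2012, §5] [cite: ChesterEtAl2020, §3.1 (functional conditions)] -/
theorem dom2mEval_le_sector2mValue (F : ScanFunctional) (D : Dims) {Δ : ℝ} {ℓ : ℕ}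
    (hΔ : unitarityBound3D ℓ < Δ) (hreg : ¬ accidentalDegeneracy3D Δ ℓ) (h1 : ℓ = 0 → Δ ≠ 1)
    {G : Label → ℝ → ℝ → ℝ} (hG₁ : IsConformalBlock3D (D.Δt - D.Δs) (D.Δt - D.Δs) Δ ℓ (G .tsts))
    (hG₂ : IsConformalBlock3D (-(D.Δt - D.Δs)) (D.Δt - D.Δs) Δ ℓ (G .stts)) :
    dom2mEval F D (G .stts) ≤ sector2mValue F D G := by
  have h14 := abs_nodeEval_crossF_gmm_le F 14 (σ := -1) (by simp) hΔ hreg h1 hG₁ hG₂ (D.expo .tsts)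
  rw [expo_tsts_add_half] at h14
  rw [dom2mEval_eq, sector2mValue]
  have a14 := le_abs_self (nodeEval F 14 (crossF (D.expo .tsts) (-1) (G .tsts)))
  linarith

/-! ### §4 The pairs series of the dominating evaluations and the termwise rules -/

/-- `𝔇₃` as two point functionals: weights `2w⁹` on `F⁻_{Δt}` and `2w¹¹ − 2(|w⁷|+|w⁸|)` on `F⁺_{Δt}`.
Bookkeeping. [cite: PappadopuloRychkovEspinRattazzi2012, §5] -/
theorem dom3Eval_eq_pointFunctional_add (F : ScanFunctional) (D : Dims) (G : ℝ → ℝ → ℝ) :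
    dom3Eval F D G = pointFunctional (fun m => 2 * F.w m 8) F.z F.zb (crossF (D.expo .φttφ) (-1) G) +
      pointFunctional (fun m => 2 * F.w m 10 - 2 * (|F.w m 6| + |F.w m 7|)) F.z F.zb
        (crossF (D.expo .φttφ) 1 G) := by
  simp only [dom3Eval, twoWeightEval, pointFunctional_apply, crossF, ← Finset.sum_add_distrib]
  exact Finset.sum_congr rfl fun m _ => by simp only [cWeight3, dWeight3]; ring

/-- `𝔇₂₋` as two point functionals: weights `2w¹⁶` on `F⁻_{Δt}` and `−2w¹⁷ − 2|w¹⁵|` on `F⁺_{Δt}`.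
Bookkeeping. [cite: PappadopuloRychkovEspinRattazzi2012, §5] -/
theorem dom2mEval_eq_pointFunctional_add (F : ScanFunctional) (D : Dims) (G : ℝ → ℝ → ℝ) :
    dom2mEval F D G = pointFunctional (fun m => 2 * F.w m 15) F.z F.zb (crossF (D.expo .stts) (-1) G) +
      pointFunctional (fun m => -(2 * F.w m 16) - 2 * |F.w m 14|) F.z F.zb (crossF (D.expo .stts) 1 G) := by
  simp only [dom2mEval, twoWeightEval, pointFunctional_apply, crossF, ← Finset.sum_add_distrib]
  exact Finset.sum_congr rfl fun m _ => by simp only [cWeight2m, dWeight2m]; ring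

/-- **Pairs series of `𝔇₃[g^{−d,d}]`** at a regular point: coefficients `A_{n,j}(d/2, d/2)/λ_ℓ`.
[cite: DolanOsborn2004, §3 eq. (3.10)] [cite: KosPolandSimmonsduffin2014, §3.3 eq. (3.16)] -/
theorem hasSum_dom3Eval (F : ScanFunctional) (D : Dims) {Δ : ℝ} {ℓ : ℕ} {G₂ : ℝ → ℝ → ℝ}
    (hΔ : unitarityBound3D ℓ < Δ) (hreg : ¬ accidentalDegeneracy3D Δ ℓ)
    (hG₂ : IsConformalBlock3D (-(D.Δt - D.Δφ)) (D.Δt - D.Δφ) Δ ℓ G₂) :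
    HasSum (fun q : ℕ × ℕ => hrCoeffAB ((D.Δt - D.Δφ) / 2) ((D.Δt - D.Δφ) / 2) Δ ℓ q.1 q.2 /
        legendreLam ℓ * dom3Term F D (Δ + (q.1 : ℝ)) q.2) (dom3Eval F D G₂) := by
  have ha := hasSum_pointFunctional_crossF_hrZAB (fun m => 2 * F.w m 8) F.z F.zb F.hz F.hzb
    (D.expo .φttφ) (-1) hΔ hreg rfl hG₂
  have hb := hasSum_pointFunctional_crossF_hrZAB (fun m => 2 * F.w m 10 - 2 * (|F.w m 6| + |F.w m 7|))
    F.z F.zb F.hz F.hzb (D.expo .φttφ) 1 hΔ hreg rfl hG₂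
  rw [dom3Eval_eq_pointFunctional_add]
  refine (ha.add hb).congr_fun fun q => ?_
  rw [dom3Term, dom3Eval_eq_pointFunctional_add]
  ring

/-- **Pairs series of `𝔇₂₋[g^{−d′,d′}]`** at a regular point: coefficients `A_{n,j}(d′/2, d′/2)/λ_ℓ`.
[cite: DolanOsborn2004, §3 eq. (3.10)] [cite: KosPolandSimmonsduffin2014, §3.3 eq. (3.16)] -/
theorem hasSum_dom2mEval (F : ScanFunctional) (D : Dims) {Δ : ℝ} {ℓ : ℕ} {G₂ : ℝ → ℝ → ℝ}
    (hΔ : unitarityBound3D ℓ < Δ) (hreg : ¬ accidentalDegeneracy3D Δ ℓ)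
    (hG₂ : IsConformalBlock3D (-(D.Δt - D.Δs)) (D.Δt - D.Δs) Δ ℓ G₂) :
    HasSum (fun q : ℕ × ℕ => hrCoeffAB ((D.Δt - D.Δs) / 2) ((D.Δt - D.Δs) / 2) Δ ℓ q.1 q.2 /
        legendreLam ℓ * dom2mTerm F D (Δ + (q.1 : ℝ)) q.2) (dom2mEval F D G₂) := by
  have ha := hasSum_pointFunctional_crossF_hrZAB (fun m => 2 * F.w m 15) F.z F.zb F.hz F.hzb
    (D.expo .stts) (-1) hΔ hreg rfl hG₂
  have hb := hasSum_pointFunctional_crossF_hrZAB (fun m => -(2 * F.w m 16) - 2 * |F.w m 14|)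
    F.z F.zb F.hz F.hzb (D.expo .stts) 1 hΔ hreg rfl hG₂
  rw [dom2mEval_eq_pointFunctional_add]
  refine (ha.add hb).congr_fun fun q => ?_
  rw [dom2mTerm, dom2mEval_eq_pointFunctional_add]
  ring

/-- **`𝔇₃ ≥ 0` from a finite head + non-negative tail.** [cite: PappadopuloRychkovEspinRattazzi2012, §5]
[cite: KosPolandSimmonsduffin2014, §3.3 eq. (3.16)] -/
theorem dom3Eval_nonneg_of_termwise (F : ScanFunctional) (D : Dims) {Δ : ℝ} {ℓ : ℕ}
    (hΔ : unitarityBound3D ℓ < Δ) (hreg : ¬ accidentalDegeneracy3D Δ ℓ) (S : Finset (ℕ × ℕ))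
    (hhead : 0 ≤ ∑ q ∈ S, hrCoeffAB ((D.Δt - D.Δφ) / 2) ((D.Δt - D.Δφ) / 2) Δ ℓ q.1 q.2 /
      legendreLam ℓ * dom3Term F D (Δ + (q.1 : ℝ)) q.2)
    (htail : ∀ q : ℕ × ℕ, q ∉ S → InDescendantRange ℓ q.1 q.2 → 0 ≤ dom3Term F D (Δ + (q.1 : ℝ)) q.2)
    {G₂ : ℝ → ℝ → ℝ} (hG₂ : IsConformalBlock3D (-(D.Δt - D.Δφ)) (D.Δt - D.Δφ) Δ ℓ G₂) :
    0 ≤ dom3Eval F D G₂ := by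
  have hS := hasSum_dom3Eval F D hΔ hreg hG₂
  refine hhead.trans (sum_le_hasSum S (fun q hq => ?_) hS)
  by_cases hr : InDescendantRange ℓ q.1 q.2
  · exact mul_nonneg (div_nonneg (hrCoeffAB_self_nonneg _ hΔ _ _) (legendreLam_pos ℓ).le)
      (htail q hq hr)
  · rw [hrCoeffAB_eq_zero_of_not_inDescendantRange _ _ Δ hr, zero_div, zero_mul]

/-- **`𝔇₂₋ ≥ 0` from a finite head + non-negative tail.** [cite: PappadopuloRychkovEspinRattazzi2012, §5]
[cite: KosPolandSimmonsduffin2014, §3.3 eq. (3.16)] -/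
theorem dom2mEval_nonneg_of_termwise (F : ScanFunctional) (D : Dims) {Δ : ℝ} {ℓ : ℕ}
    (hΔ : unitarityBound3D ℓ < Δ) (hreg : ¬ accidentalDegeneracy3D Δ ℓ) (S : Finset (ℕ × ℕ))
    (hhead : 0 ≤ ∑ q ∈ S, hrCoeffAB ((D.Δt - D.Δs) / 2) ((D.Δt - D.Δs) / 2) Δ ℓ q.1 q.2 /
      legendreLam ℓ * dom2mTerm F D (Δ + (q.1 : ℝ)) q.2)
    (htail : ∀ q : ℕ × ℕ, q ∉ S → InDescendantRange ℓ q.1 q.2 → 0 ≤ dom2mTerm F D (Δ + (q.1 : ℝ)) q.2)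
    {G₂ : ℝ → ℝ → ℝ} (hG₂ : IsConformalBlock3D (-(D.Δt - D.Δs)) (D.Δt - D.Δs) Δ ℓ G₂) :
    0 ≤ dom2mEval F D G₂ := by
  have hS := hasSum_dom2mEval F D hΔ hreg hG₂
  refine hhead.trans (sum_le_hasSum S (fun q hq => ?_) hS)
  by_cases hr : InDescendantRange ℓ q.1 q.2
  · exact mul_nonneg (div_nonneg (hrCoeffAB_self_nonneg _ hΔ _ _) (legendreLam_pos ℓ).le)
      (htail q hq hr)
  · rw [hrCoeffAB_eq_zero_of_not_inDescendantRange _ _ Δ hr, zero_div, zero_mul]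

/-- `|(-1)^ℓ| ≤ 1`. Bookkeeping. [cite: ChesterEtAl2020, App. «Crossing vectors» (`V⃗_{3,Δ,ℓ}`, `ε = (−1)^ℓ`)] -/
theorem abs_neg_one_pow_le_one (ℓ : ℕ) : |((-1 : ℝ) ^ ℓ)| ≤ 1 := by
  rw [abs_pow, abs_neg, abs_one, one_pow]

/-- `Pos3` from nonnegativity of the sector-`3` value on genuine `z`-coordinate blocks.
[cite: ChesterEtAl2020, §3.1 (functional conditions)] -/
theorem pos3_of_forall_sector3Value_nonneg (F : ScanFunctional) (D : Dims) {Δ : ℝ} {ℓ : ℕ}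
    (h : ∀ G : Label → ℝ → ℝ → ℝ,
      IsConformalBlock3D (D.Δt - D.Δφ) (D.Δt - D.Δφ) Δ ℓ (G .tφtφ) →
      IsConformalBlock3D (-(D.Δt - D.Δφ)) (D.Δt - D.Δφ) Δ ℓ (G .φttφ) →
      0 ≤ sector3Value F D ((-1) ^ ℓ) G) :
    Pos3 F.toFunctional D Δ ℓ := by
  intro g hg
  rw [sector3Value_eq]
  have hb := blocks_of_genuineOn_labels3 hg
  exact h _ hb.1 hb.2

/-- `Pos2m` from nonnegativity of the sector-`2⁻` value on genuine `z`-coordinate blocks.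
[cite: ChesterEtAl2020, §3.1 (functional conditions)] -/
theorem pos2m_of_forall_sector2mValue_nonneg (F : ScanFunctional) (D : Dims) {Δ : ℝ} {ℓ : ℕ}
    (h : ∀ G : Label → ℝ → ℝ → ℝ,
      IsConformalBlock3D (D.Δt - D.Δs) (D.Δt - D.Δs) Δ ℓ (G .tsts) →
      IsConformalBlock3D (-(D.Δt - D.Δs)) (D.Δt - D.Δs) Δ ℓ (G .stts) →
      0 ≤ sector2mValue F D G) :
    Pos2m F.toFunctional D Δ ℓ := by
  intro g hg
  rw [sector2mValue_eq]
  have hb := blocks_of_genuineOn_labels2m hg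
  exact h _ hb.1 hb.2

/-- **Sector `3` at a regular `(Δ, ℓ)` from termwise domination** (finite head + non-negative dominated
tail terms; `Δ ≠ 1` if `ℓ = 0`). [cite: PappadopuloRychkovEspinRattazzi2012, §5]
[cite: KosPolandSimmonsduffin2014, §3.3 eq. (3.16)] [cite: ChesterEtAl2020, §3.1 (functional conditions)] -/
theorem pos3_of_dom_termwise (F : ScanFunctional) (D : Dims) {Δ : ℝ} {ℓ : ℕ}
    (hΔ : unitarityBound3D ℓ < Δ) (hreg : ¬ accidentalDegeneracy3D Δ ℓ) (h1 : ℓ = 0 → Δ ≠ 1)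
    (S : Finset (ℕ × ℕ))
    (hhead : 0 ≤ ∑ q ∈ S, hrCoeffAB ((D.Δt - D.Δφ) / 2) ((D.Δt - D.Δφ) / 2) Δ ℓ q.1 q.2 /
      legendreLam ℓ * dom3Term F D (Δ + (q.1 : ℝ)) q.2)
    (htail : ∀ q : ℕ × ℕ, q ∉ S → InDescendantRange ℓ q.1 q.2 → 0 ≤ dom3Term F D (Δ + (q.1 : ℝ)) q.2) :
    Pos3 F.toFunctional D Δ ℓ :=
  pos3_of_forall_sector3Value_nonneg F D fun _ hG₁ hG₂ =>
    (dom3Eval_nonneg_of_termwise F D hΔ hreg S hhead htail hG₂).trans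
      (dom3Eval_le_sector3Value F D (abs_neg_one_pow_le_one ℓ) hΔ hreg h1 hG₁ hG₂)

/-- **Sector `2⁻` at a regular `(Δ, ℓ)` from termwise domination.** [cite: PappadopuloRychkovEspinRattazzi2012, §5]
[cite: KosPolandSimmonsduffin2014, §3.3 eq. (3.16)] [cite: ChesterEtAl2020, §3.1 (functional conditions)] -/
theorem pos2m_of_dom_termwise (F : ScanFunctional) (D : Dims) {Δ : ℝ} {ℓ : ℕ}
    (hΔ : unitarityBound3D ℓ < Δ) (hreg : ¬ accidentalDegeneracy3D Δ ℓ) (h1 : ℓ = 0 → Δ ≠ 1)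
    (S : Finset (ℕ × ℕ))
    (hhead : 0 ≤ ∑ q ∈ S, hrCoeffAB ((D.Δt - D.Δs) / 2) ((D.Δt - D.Δs) / 2) Δ ℓ q.1 q.2 /
      legendreLam ℓ * dom2mTerm F D (Δ + (q.1 : ℝ)) q.2)
    (htail : ∀ q : ℕ × ℕ, q ∉ S → InDescendantRange ℓ q.1 q.2 → 0 ≤ dom2mTerm F D (Δ + (q.1 : ℝ)) q.2) :
    Pos2m F.toFunctional D Δ ℓ :=
  pos2m_of_forall_sector2mValue_nonneg F D fun _ hG₁ hG₂ =>
    (dom2mEval_nonneg_of_termwise F D hΔ hreg S hhead htail hG₂).trans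
      (dom2mEval_le_sector2mValue F D hΔ hreg h1 hG₁ hG₂)

/-- **Fully termwise form, sector `3`.** [cite: PappadopuloRychkovEspinRattazzi2012, §5] [cite: ChesterEtAl2020, §3.1 (functional conditions)] -/
theorem pos3_of_dom_forall (F : ScanFunctional) (D : Dims) {Δ : ℝ} {ℓ : ℕ}
    (hΔ : unitarityBound3D ℓ < Δ) (hreg : ¬ accidentalDegeneracy3D Δ ℓ) (h1 : ℓ = 0 → Δ ≠ 1)
    (hterm : ∀ q : ℕ × ℕ, InDescendantRange ℓ q.1 q.2 → 0 ≤ dom3Term F D (Δ + (q.1 : ℝ)) q.2) :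
    Pos3 F.toFunctional D Δ ℓ :=
  pos3_of_dom_termwise F D hΔ hreg h1 ∅ (by simp) (fun q _ hr => hterm q hr)

/-- **Fully termwise form, sector `2⁻`.** [cite: PappadopuloRychkovEspinRattazzi2012, §5] [cite: ChesterEtAl2020, §3.1 (functional conditions)] -/
theorem pos2m_of_dom_forall (F : ScanFunctional) (D : Dims) {Δ : ℝ} {ℓ : ℕ}
    (hΔ : unitarityBound3D ℓ < Δ) (hreg : ¬ accidentalDegeneracy3D Δ ℓ) (h1 : ℓ = 0 → Δ ≠ 1)
    (hterm : ∀ q : ℕ × ℕ, InDescendantRange ℓ q.1 q.2 → 0 ≤ dom2mTerm F D (Δ + (q.1 : ℝ)) q.2) :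
    Pos2m F.toFunctional D Δ ℓ :=
  pos2m_of_dom_termwise F D hΔ hreg h1 ∅ (by simp) (fun q _ hr => hterm q hr)

/-! ### §5 Non-regular points by right limits -/

/-- Approximating families at a non-regular point for blocks with label-dependent `(Δ_ij, Δ_kl)` (limit
clause of `IsConformalBlock3D`, one approximant per label). [cite: KosPolandSimmonsduffin2014, §4 eqs. (4.2)–(4.3)] -/
theorem exists_approximants_of_not_isRegularPoint3D' {Δ : ℝ} {ℓ : ℕ} (hΔ : ¬ IsRegularPoint3D Δ ℓ)
    (S : List Label) (a b : Label → ℝ) {G : Label → ℝ → ℝ → ℝ}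
    (hG : ∀ L ∈ S, IsConformalBlock3D (a L) (b L) Δ ℓ (G L)) :
    ∃ Gf : ℝ → Label → ℝ → ℝ → ℝ,
      (∀ L ∈ S, ∀ Δ' ∈ Ioo Δ (Δ + 1), IsConformalBlock3DAbove (a L) (b L) Δ' ℓ (Gf Δ' L)) ∧
      ∀ L ∈ S, ∀ x y : ℝ, x ∈ Ioo (0 : ℝ) 1 → y ∈ Ioo (0 : ℝ) 1 →
        Tendsto (fun Δ' => Gf Δ' L x y) (𝓝[>] Δ) (𝓝 (G L x y)) := by
  have hex : ∀ L : Label, ∃ H : ℝ → ℝ → ℝ → ℝ, L ∈ S →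
      (∀ Δ' ∈ Ioo Δ (Δ + 1), IsConformalBlock3DAbove (a L) (b L) Δ' ℓ (H Δ')) ∧
        ∀ x y : ℝ, x ∈ Ioo (0 : ℝ) 1 → y ∈ Ioo (0 : ℝ) 1 →
          Tendsto (fun Δ' => H Δ' x y) (𝓝[>] Δ) (𝓝 (G L x y)) := by
    intro L
    by_cases hL : L ∈ S
    · rcases hG L hL with ⟨hreg, _⟩ | ⟨_, H, hHa, hHl⟩
      · exact absurd hreg hΔ
      · exact ⟨H, fun _ => ⟨hHa, hHl⟩⟩
    · exact ⟨fun _ _ _ => 0, fun h => absurd h hL⟩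
  choose H hH using hex
  exact ⟨fun Δ' L => H L Δ', fun L hL => (hH L hL).1, fun L hL => (hH L hL).2⟩

/-- The sector-`3` value is continuous along pointwise convergence of the two blocks on the open square.
Elementary (finitely many node values). [cite: KosPolandSimmonsduffin2014, §4 eqs. (4.2)–(4.3)] -/
theorem tendsto_sector3Value (F : ScanFunctional) (D : Dims) (ε : ℝ) (Gf : ℝ → Label → ℝ → ℝ → ℝ)
    (G : Label → ℝ → ℝ → ℝ) (l : Filter ℝ)
    (hG : ∀ L ∈ labels3, ∀ x y : ℝ, x ∈ Ioo (0 : ℝ) 1 → y ∈ Ioo (0 : ℝ) 1 →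
      Tendsto (fun Δ' => Gf Δ' L x y) l (𝓝 (G L x y))) :
    Tendsto (fun Δ' => sector3Value F D ε (Gf Δ')) l (𝓝 (sector3Value F D ε G)) := by
  have h₁ : Label.tφtφ ∈ labels3 := by simp [labels3]
  have h₂ : Label.φttφ ∈ labels3 := by simp [labels3]
  have T := fun (r : Fin 22) (x sgn : ℝ) {L : Label} (hL : L ∈ labels3) =>
    tendsto_pointFunctional_crossF (fun m => F.w m r) F.z F.zb F.hz F.hzb x sgn (fun Δ' => Gf Δ' L) (G L) l
      (hG L hL)
  simp only [sector3Value, nodeEval]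
  exact ((((T 6 (D.expo .tφtφ) (-1) h₁).const_mul (2 * ε)).sub
      ((T 7 (D.expo .tφtφ) 1 h₁).const_mul (2 * ε))).add ((T 8 (D.expo .φttφ) (-1) h₂).const_mul 2)).add
    ((T 10 (D.expo .φttφ) 1 h₂).const_mul 2)

/-- The sector-`2⁻` value is continuous along pointwise convergence of the two blocks. Elementary.
[cite: KosPolandSimmonsduffin2014, §4 eqs. (4.2)–(4.3)] -/
theorem tendsto_sector2mValue (F : ScanFunctional) (D : Dims) (Gf : ℝ → Label → ℝ → ℝ → ℝ)
    (G : Label → ℝ → ℝ → ℝ) (l : Filter ℝ)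
    (hG : ∀ L ∈ labels2m, ∀ x y : ℝ, x ∈ Ioo (0 : ℝ) 1 → y ∈ Ioo (0 : ℝ) 1 →
      Tendsto (fun Δ' => Gf Δ' L x y) l (𝓝 (G L x y))) :
    Tendsto (fun Δ' => sector2mValue F D (Gf Δ')) l (𝓝 (sector2mValue F D G)) := by
  have h₁ : Label.tsts ∈ labels2m := by simp [labels2m]
  have h₂ : Label.stts ∈ labels2m := by simp [labels2m]
  have T := fun (r : Fin 22) (x sgn : ℝ) {L : Label} (hL : L ∈ labels2m) =>
    tendsto_pointFunctional_crossF (fun m => F.w m r) F.z F.zb F.hz F.hzb x sgn (fun Δ' => Gf Δ' L) (G L) l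
      (hG L hL)
  simp only [sector2mValue, nodeEval]
  exact ((((T 14 (D.expo .tsts) (-1) h₁).const_mul 2).neg.add ((T 15 (D.expo .stts) (-1) h₂).const_mul 2)).sub
    ((T 16 (D.expo .stts) 1 h₂).const_mul 2))

/-- **Sector `3` at a NON-REGULAR point from the right**: if `(Δ, ℓ)` is not regular and for all `Δ'` in a
right neighbourhood `(Δ', ℓ)` is regular and the sector-`3` value is `≥ 0` on genuine blocks at `(Δ', ℓ)`
(e.g. by `pos3_of_dom_termwise`; note `Δ' ≠ 1` eventually), then `Pos3` at `(Δ, ℓ)`.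
[cite: KosPolandSimmonsduffin2014, §4 eqs. (4.2)–(4.3)] [cite: ChesterEtAl2020, §3.1 (functional conditions)] -/
theorem pos3_of_eventually_right (F : ScanFunctional) (D : Dims) {Δ : ℝ} {ℓ : ℕ}
    (hΔ : ¬ IsRegularPoint3D Δ ℓ)
    (h : ∀ᶠ Δ' in 𝓝[>] Δ, IsRegularPoint3D Δ' ℓ ∧ ∀ G : Label → ℝ → ℝ → ℝ,
      IsConformalBlock3D (D.Δt - D.Δφ) (D.Δt - D.Δφ) Δ' ℓ (G .tφtφ) →
      IsConformalBlock3D (-(D.Δt - D.Δφ)) (D.Δt - D.Δφ) Δ' ℓ (G .φttφ) →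
      0 ≤ sector3Value F D ((-1) ^ ℓ) G) :
    Pos3 F.toFunctional D Δ ℓ := by
  refine pos3_of_forall_sector3Value_nonneg F D fun G hG₁ hG₂ => ?_
  let a : Label → ℝ := fun L => match L with | .tφtφ => D.Δt - D.Δφ | _ => -(D.Δt - D.Δφ)
  have hGS : ∀ L ∈ labels3, IsConformalBlock3D (a L) (D.Δt - D.Δφ) Δ ℓ (G L) := by
    intro L hL
    simp only [labels3, List.mem_cons, List.not_mem_nil, or_false] at hL
    rcases hL with rfl | rfl
    · simpa [a] using hG₁
    · simpa [a] using hG₂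
  obtain ⟨Gf, hGa, hGl⟩ := exists_approximants_of_not_isRegularPoint3D' hΔ labels3 a
    (fun _ => D.Δt - D.Δφ) hGS
  have hlim := tendsto_sector3Value F D ((-1) ^ ℓ) Gf G (𝓝[>] Δ) hGl
  refine ge_of_tendsto hlim ?_
  have hIoo : Ioo Δ (Δ + 1) ∈ 𝓝[>] Δ := Ioo_mem_nhdsGT (by linarith)
  filter_upwards [h, hIoo] with Δ' hΔ' hmem
  have h₁ := hGa .tφtφ (by simp [labels3]) Δ' hmem
  have h₂ := hGa .φttφ (by simp [labels3]) Δ' hmem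
  simp only [a] at h₁ h₂
  exact hΔ'.2 (Gf Δ') (Or.inl ⟨hΔ'.1, by simpa using h₁⟩) (Or.inl ⟨hΔ'.1, by simpa using h₂⟩)

/-- **Sector `2⁻` at a NON-REGULAR point from the right.** [cite: KosPolandSimmonsduffin2014, §4 eqs. (4.2)–(4.3)]
[cite: ChesterEtAl2020, §3.1 (functional conditions)] -/
theorem pos2m_of_eventually_right (F : ScanFunctional) (D : Dims) {Δ : ℝ} {ℓ : ℕ}
    (hΔ : ¬ IsRegularPoint3D Δ ℓ)
    (h : ∀ᶠ Δ' in 𝓝[>] Δ, IsRegularPoint3D Δ' ℓ ∧ ∀ G : Label → ℝ → ℝ → ℝ,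
      IsConformalBlock3D (D.Δt - D.Δs) (D.Δt - D.Δs) Δ' ℓ (G .tsts) →
      IsConformalBlock3D (-(D.Δt - D.Δs)) (D.Δt - D.Δs) Δ' ℓ (G .stts) →
      0 ≤ sector2mValue F D G) :
    Pos2m F.toFunctional D Δ ℓ := by
  refine pos2m_of_forall_sector2mValue_nonneg F D fun G hG₁ hG₂ => ?_
  let a : Label → ℝ := fun L => match L with | .tsts => D.Δt - D.Δs | _ => -(D.Δt - D.Δs)
  have hGS : ∀ L ∈ labels2m, IsConformalBlock3D (a L) (D.Δt - D.Δs) Δ ℓ (G L) := by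
    intro L hL
    simp only [labels2m, List.mem_cons, List.not_mem_nil, or_false] at hL
    rcases hL with rfl | rfl
    · simpa [a] using hG₁
    · simpa [a] using hG₂
  obtain ⟨Gf, hGa, hGl⟩ := exists_approximants_of_not_isRegularPoint3D' hΔ labels2m a
    (fun _ => D.Δt - D.Δs) hGS
  have hlim := tendsto_sector2mValue F D Gf G (𝓝[>] Δ) hGl
  refine ge_of_tendsto hlim ?_
  have hIoo : Ioo Δ (Δ + 1) ∈ 𝓝[>] Δ := Ioo_mem_nhdsGT (by linarith)
  filter_upwards [h, hIoo] with Δ' hΔ' hmem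
  have h₁ := hGa .tsts (by simp [labels2m]) Δ' hmem
  have h₂ := hGa .stts (by simp [labels2m]) Δ' hmem
  simp only [a] at h₁ h₂
  exact hΔ'.2 (Gf Δ') (Or.inl ⟨hΔ'.1, by simpa using h₁⟩) (Or.inl ⟨hΔ'.1, by simpa using h₂⟩)

end Literature.MathematicalPhysics.QuantumFieldTheory.O2ChargedSectorsTermwise
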